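import Mathlib.Analysis.InnerProductSpace.PiL2
import Mathlib.Analysis.SpecialFunctions.Complex.Arg
import Mathlib.Analysis.SpecialFunctions.Trigonometric.Bounds
import Mathlib.Analysis.Real.Pi.Bounds
import Mathlib.Data.Finset.Sort
import HarnessLib

/-!
# Two kissing-type counts along an axis: `≤ 3` contacts in a `35°` cone, `≤ 6` in a thin band

HONEST FRAMING. Part of the venture `Summits/Ventures/Crystal3D` (cell `crystal3d-full`), helper
lemmas `--supports` the crux `NoReconstructionGain` (stmt-Ventures-19144, route
`route-Ventures-StickyWulffConstant`): the two local counts behind the steep-or-flat layer bound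
(`StickyWulffConstantNoReconstructionGainSteepFlat.lean`).  Elementary geometry of unit vectors of
`ℝ³` with pairwise inner products `≤ 1/2` (contact directions of a ball in a unit packing are
pairwise `≥ 60°` apart); nothing here is a claim about packings or crystallization.

* `no_four_in_cone`, `card_cone_le_three`, `card_negCone_le_three` — at most THREE such vectors
  have third coordinate `≥ t` (resp. `≤ −t`) when `t ≥ 0`, `t² > 5/8` (so for `t = √(2/3)`:
  polar angle `≤ 35.26°`, the three up-hollow directions of a close-packed layer are extremal):
  the sum `s` of four of them would have `s₂ ≥ 4t` but `‖s‖² ≤ 4 + 12·(1/2) = 10 < 16t²`.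
* `no_seven_in_thin_band`, `card_thin_band_le_six` — at most SIX such vectors lie in the band
  `|u₂| ≤ 1/5` (six is attained by a planar hexagon): Musin-type projection to the horizontal
  plane (`ρ² = 1 − z² ≥ 24/25` forces `cos (θᵢ − θⱼ) ≤ 9/16`), `9/16 < cos (2π/7)` from
  `1 − x²/2 ≤ cos x` and `π < 3.15`, and seven directions pairwise more than `2π/7` apart do not
  fit around the circle (`seven_sorted_angles_false`, after `eight_sorted_angles_false` of
  `Literature/Geometry/DiscreteGeometry/OneSidedKissingNumberThree.lean`).

WHAT THIS IS NOT: not the kissing number, not the one-sided kissing number (both in the tree);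
rung F-C1 is not moved by local counts.
-/

noncomputable section

namespace Summit.Ventures.Crystal3D.Theorems

open Summit.Ventures.Crystal3D Finset Real
open scoped InnerProductSpace

/-! ## Unit vectors at distance `≥ 1` -/

/-- Two unit vectors at distance `≥ 1` have inner product `≤ 1/2`. -/
theorem inner_le_half_of_one_le_dist {u v : (EuclideanSpace ℝ (Fin 3))} (hu : ‖u‖ = 1) (hv : ‖v‖ = 1)
    (h : 1 ≤ dist u v) : ⟪u, v⟫_ℝ ≤ 1 / 2 := by
  have h1 : dist u v ^ 2 = ‖u‖ ^ 2 - 2 * ⟪u, v⟫_ℝ + ‖v‖ ^ 2 := by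
    rw [dist_eq_norm, norm_sub_sq_real]
  have h2 : 1 ≤ dist u v ^ 2 := by nlinarith
  rw [hu, hv] at h1
  linarith

/-! ## The cone lemma: at most three contacts within `35.26°` of a pole -/

/-- **Cone lemma.** Four unit vectors of `ℝ³` with third coordinate `≥ t`, `t ≥ 0`, `t² > 5/8`
(e.g. `t = √(2/3)`, polar angle `≤ 35.26°`) and pairwise inner products `≤ 1/2` do not exist:
their sum `s` would have `s₂ ≥ 4t` but `‖s‖² ≤ 4 + 12·(1/2) = 10 < 16 t²`. -/
theorem no_four_in_cone (t : ℝ) (ht0 : 0 ≤ t) (ht : 5 / 8 < t ^ 2) (v : Fin 4 → (EuclideanSpace ℝ (Fin 3)))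
    (hn : ∀ k, ‖v k‖ = 1) (hz : ∀ k, t ≤ v k 2)
    (hsep : ∀ i j, i ≠ j → ⟪v i, v j⟫_ℝ ≤ 1 / 2) : False := by
  set s : (EuclideanSpace ℝ (Fin 3)) := v 0 + v 1 + v 2 + v 3 with hs
  have hself : ∀ k, ⟪v k, v k⟫_ℝ = 1 := fun k => by
    rw [real_inner_self_eq_norm_sq, hn k]; norm_num
  have hnorm : ‖s‖ ^ 2 ≤ 10 := by
    rw [← real_inner_self_eq_norm_sq, hs]
    simp only [inner_add_left, inner_add_right]
    have h01 := hsep 0 1 (by decide); have h02 := hsep 0 2 (by decide)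
    have h03 := hsep 0 3 (by decide); have h12 := hsep 1 2 (by decide)
    have h13 := hsep 1 3 (by decide); have h23 := hsep 2 3 (by decide)
    have h10 : ⟪v 1, v 0⟫_ℝ ≤ 1 / 2 := by rw [real_inner_comm]; exact h01
    have h20 : ⟪v 2, v 0⟫_ℝ ≤ 1 / 2 := by rw [real_inner_comm]; exact h02
    have h30 : ⟪v 3, v 0⟫_ℝ ≤ 1 / 2 := by rw [real_inner_comm]; exact h03
    have h21 : ⟪v 2, v 1⟫_ℝ ≤ 1 / 2 := by rw [real_inner_comm]; exact h12
    have h31 : ⟪v 3, v 1⟫_ℝ ≤ 1 / 2 := by rw [real_inner_comm]; exact h13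
    have h32 : ⟪v 3, v 2⟫_ℝ ≤ 1 / 2 := by rw [real_inner_comm]; exact h23
    linarith [hself 0, hself 1, hself 2, hself 3]
  have hs2 : s 2 = v 0 2 + v 1 2 + v 2 2 + v 3 2 := by
    simp [hs]
  have hs2ge : 4 * t ≤ s 2 := by rw [hs2]; linarith [hz 0, hz 1, hz 2, hz 3]
  have hcoord : s 2 ^ 2 ≤ ‖s‖ ^ 2 := by
    rw [EuclideanSpace.real_norm_sq_eq, Fin.sum_univ_three]
    nlinarith [sq_nonneg (s 0), sq_nonneg (s 1)]
  have h4t : 0 ≤ 4 * t := by linarith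
  have : (4 * t) ^ 2 ≤ s 2 ^ 2 := pow_le_pow_left₀ h4t hs2ge 2
  nlinarith

/-- **At most three in a cone.** A finite set of unit vectors of `ℝ³` with third coordinates
`≥ t` (`t ≥ 0`, `t² > 5/8`) and pairwise inner products `≤ 1/2` has at most three elements. -/
theorem card_cone_le_three (t : ℝ) (ht0 : 0 ≤ t) (ht : 5 / 8 < t ^ 2) {F : Finset (EuclideanSpace ℝ (Fin 3))}
    (hn : ∀ u ∈ F, ‖u‖ = 1) (hz : ∀ u ∈ F, t ≤ u 2)
    (hsep : ∀ u ∈ F, ∀ w ∈ F, u ≠ w → ⟪u, w⟫_ℝ ≤ 1 / 2) : F.card ≤ 3 := by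
  by_contra h
  obtain ⟨F', hF', hcard⟩ := Finset.exists_subset_card_eq (show 4 ≤ F.card by omega)
  set eqv := (Finset.equivFinOfCardEq hcard).symm with heqv
  refine no_four_in_cone t ht0 ht (fun k => ((eqv k : F') : (EuclideanSpace ℝ (Fin 3)))) (fun k => hn _ (hF' (eqv k).2))
    (fun k => hz _ (hF' (eqv k).2))
    fun i j hij => hsep _ (hF' (eqv i).2) _ (hF' (eqv j).2) ?_
  exact fun h => hij (eqv.injective (Subtype.val_injective h))

/-- The mirrored cone: third coordinates `≤ −t`. -/
theorem card_negCone_le_three (t : ℝ) (ht0 : 0 ≤ t) (ht : 5 / 8 < t ^ 2) {F : Finset (EuclideanSpace ℝ (Fin 3))}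
    (hn : ∀ u ∈ F, ‖u‖ = 1) (hz : ∀ u ∈ F, u 2 ≤ -t)
    (hsep : ∀ u ∈ F, ∀ w ∈ F, u ≠ w → ⟪u, w⟫_ℝ ≤ 1 / 2) : F.card ≤ 3 := by
  classical
  have hinj : Set.InjOn (fun u : (EuclideanSpace ℝ (Fin 3)) => -u) ↑F := fun u _ w _ h => neg_injective h
  rw [← Finset.card_image_of_injOn hinj]
  refine card_cone_le_three t ht0 ht ?_ ?_ ?_
  · intro u hu
    obtain ⟨w, hw, rfl⟩ := Finset.mem_image.1 hu
    rw [norm_neg]; exact hn w hw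
  · intro u hu
    obtain ⟨w, hw, rfl⟩ := Finset.mem_image.1 hu
    have := hz w hw
    show t ≤ (-w) 2
    simp only [PiLp.neg_apply]; linarith
  · intro u hu w hw huw
    obtain ⟨u', hu', rfl⟩ := Finset.mem_image.1 hu
    obtain ⟨w', hw', rfl⟩ := Finset.mem_image.1 hw
    rw [inner_neg_left, inner_neg_right, neg_neg]
    exact hsep u' hu' w' hw' fun h => huw (by rw [h])


/-! ## The band lemma: at most six contacts in the band `|Δz| ≤ 1/5` -/

/-- `cos (2π/7) > 9/16`: from `1 − x²/2 ≤ cos x` and `π < 3.15`. -/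
theorem nine_sixteenth_lt_cos_two_pi_div_seven : (9 : ℝ) / 16 < cos (2 * π / 7) := by
  have h1 := Real.one_sub_sq_div_two_le_cos (x := 2 * π / 7)
  have hpi := Real.pi_lt_d2
  have hpi0 := Real.pi_pos
  have h2 : (2 * π / 7) ^ 2 < 7 / 8 := by nlinarith
  linarith

/-- An angle in `[0, 2π/7]` has cosine `> 9/16`. -/
theorem nine_sixteenth_lt_cos {y : ℝ} (h0 : 0 ≤ y) (h1 : y ≤ 2 * π / 7) : (9 : ℝ) / 16 < cos y :=
  lt_of_lt_of_le nine_sixteenth_lt_cos_two_pi_div_seven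
    (Real.cos_le_cos_of_nonneg_of_le_pi h0 (by linarith [Real.pi_pos]) h1)

/-- **No seven sorted directions.** Seven angles `−π < t₀ < ⋯ < t₆ ≤ π` all of whose pairwise
differences have cosine `≤ 9/16 < cos (2π/7)` do not exist: the six consecutive gaps and the
wrap-around gap `2π − (t₆ − t₀)` would each exceed `2π/7`, but they sum to `2π`. -/
theorem seven_sorted_angles_false (t : Fin 7 → ℝ) (hmono : StrictMono t)
    (hlo : -π < t 0) (hhi : t 6 ≤ π)
    (hC : ∀ i j, i ≠ j → cos (t i - t j) ≤ 9 / 16) : False := by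
  have hgap : ∀ i j : Fin 7, i < j → 2 * π / 7 < t j - t i := by
    intro i j hij
    have hpos : 0 < t j - t i := sub_pos.2 (hmono hij)
    by_contra h
    have h1 := nine_sixteenth_lt_cos hpos.le (not_lt.1 h)
    have h2 := hC j i (ne_of_gt hij)
    linarith
  have h01 := hgap 0 1 (by decide)
  have h12 := hgap 1 2 (by decide)
  have h23 := hgap 2 3 (by decide)
  have h34 := hgap 3 4 (by decide)
  have h45 := hgap 4 5 (by decide)
  have h56 := hgap 5 6 (by decide)
  have hw0 : 0 ≤ 2 * π - (t 6 - t 0) := by linarith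
  by_cases hw1 : 2 * π - (t 6 - t 0) ≤ 2 * π / 7
  · have h1 := nine_sixteenth_lt_cos hw0 hw1
    rw [Real.cos_two_pi_sub] at h1
    have h2 := hC 6 0 (by decide)
    linarith
  · have hw1 := not_le.1 hw1
    linarith [Real.pi_pos]

/-- **No seven in the thin band.** Seven unit vectors of `ℝ³` with `|u₂| ≤ 1/5` and pairwise inner
products `≤ 1/2` (angular separation `≥ 60°`) do not exist.  Musin-type projection: writing
`u = (ρ cos θ, ρ sin θ, z)` with `ρ² = 1 − z² ≥ 24/25`, `⟪uᵢ, uⱼ⟫ ≤ 1/2` forces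
`cos (θᵢ − θⱼ) ≤ (1/2 + 1/25)/(24/25) = 9/16 < cos (2π/7)`, and seven directions pairwise more than
`2π/7` apart do not fit around the circle. -/
theorem no_seven_in_thin_band (u : Fin 7 → (EuclideanSpace ℝ (Fin 3))) (hn : ∀ k, ‖u k‖ = 1)
    (hz : ∀ k, |u k 2| ≤ 1 / 5) (hsep : ∀ i j, i ≠ j → ⟪u i, u j⟫_ℝ ≤ 1 / 2) : False := by
  set X : Fin 7 → ℝ := fun k => u k 0 with hXdef
  set Y : Fin 7 → ℝ := fun k => u k 1 with hYdef
  set Z : Fin 7 → ℝ := fun k => u k 2 with hZdef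
  have hXYZ : ∀ k, X k ^ 2 + Y k ^ 2 + Z k ^ 2 = 1 := by
    intro k
    have h1 : ‖u k‖ ^ 2 = u k 0 ^ 2 + u k 1 ^ 2 + u k 2 ^ 2 := by
      rw [EuclideanSpace.real_norm_sq_eq, Fin.sum_univ_three]
    rw [hn k, one_pow] at h1
    simp only [hXdef, hYdef, hZdef]
    linarith
  -- polar form of the horizontal part
  set ρ : Fin 7 → ℝ := fun k => ‖(⟨X k, Y k⟩ : ℂ)‖ with hρdef
  set θ : Fin 7 → ℝ := fun k => Complex.arg ⟨X k, Y k⟩ with hθdef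
  have hXρ : ∀ k, X k = ρ k * cos (θ k) := fun k => (Complex.norm_mul_cos_arg ⟨X k, Y k⟩).symm
  have hYρ : ∀ k, Y k = ρ k * sin (θ k) := fun k => (Complex.norm_mul_sin_arg ⟨X k, Y k⟩).symm
  have hρ0 : ∀ k, 0 ≤ ρ k := fun k => norm_nonneg _
  have hρsq : ∀ k, ρ k ^ 2 = 1 - Z k ^ 2 := by
    intro k
    have h1 : ρ k ^ 2 = X k ^ 2 + Y k ^ 2 := by
      simp only [hρdef]
      rw [Complex.sq_norm, Complex.normSq_mk]
      ring
    linarith [hXYZ k]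
  have hZsq : ∀ k, Z k ^ 2 ≤ 1 / 25 := by
    intro k
    have h := hz k
    simp only [hZdef]
    have h' : |u k 2| ^ 2 ≤ (1 / 5) ^ 2 := pow_le_pow_left₀ (abs_nonneg _) h 2
    rw [sq_abs] at h'
    linarith
  have hinner : ∀ i j, ⟪u i, u j⟫_ℝ = ρ i * ρ j * cos (θ i - θ j) + Z i * Z j := by
    intro i j
    have hin : ⟪u i, u j⟫_ℝ = u i 0 * u j 0 + u i 1 * u j 1 + u i 2 * u j 2 := by
      simp [PiLp.inner_apply, Fin.sum_univ_three, mul_comm]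
    rw [hin, cos_sub]
    have hXi := hXρ i
    have hXj := hXρ j
    have hYi := hYρ i
    have hYj := hYρ j
    simp only [hXdef, hYdef] at hXi hXj hYi hYj
    simp only [hZdef]
    rw [hXi, hXj, hYi, hYj]
    ring
  -- the planar separation: cos (θ i − θ j) ≤ 9/16
  have hC : ∀ i j, i ≠ j → cos (θ i - θ j) ≤ 9 / 16 := by
    intro i j hij
    by_contra hc
    have hc := not_le.1 hc
    have h := hsep i j hij
    rw [hinner] at h
    have hZi := abs_le.1 (hz i)
    have hZj := abs_le.1 (hz j)
    simp only at hZi hZj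
    have hZZ : -(1 / 25) ≤ Z i * Z j := by
      simp only [hZdef]
      nlinarith [mul_nonneg (show (0:ℝ) ≤ 1/5 + u i 2 by linarith [hZi.1])
        (show (0:ℝ) ≤ 1/5 + u j 2 by linarith [hZj.1]),
        mul_nonneg (show (0:ℝ) ≤ 1/5 - u i 2 by linarith [hZi.2])
        (show (0:ℝ) ≤ 1/5 - u j 2 by linarith [hZj.2])]
    have hρρsq : (24 / 25) ^ 2 ≤ (ρ i * ρ j) ^ 2 := by
      rw [mul_pow, hρsq i, hρsq j]; nlinarith [hZsq i, hZsq j]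
    have hρρ : 24 / 25 ≤ ρ i * ρ j := by
      nlinarith [mul_nonneg (hρ0 i) (hρ0 j)]
    have h1 : 24 / 25 * (9 / 16) < ρ i * ρ j * cos (θ i - θ j) := by
      calc 24 / 25 * (9 / 16 : ℝ) ≤ ρ i * ρ j * (9 / 16) := by nlinarith
        _ < ρ i * ρ j * cos (θ i - θ j) := by
          apply mul_lt_mul_of_pos_left hc
          exact lt_of_lt_of_le (by norm_num) hρρ
    linarith
  -- the angles are pairwise distinct
  have hθinj : Function.Injective θ := by
    intro i j hij
    by_contra hne
    have h := hC i j hne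
    rw [hij, sub_self, Real.cos_zero] at h
    linarith
  -- sort the seven angles and count gaps
  have hAcard : (Finset.univ.image θ).card = 7 := by
    rw [Finset.card_image_of_injective _ hθinj, Finset.card_univ, Fintype.card_fin]
  let emb := (Finset.univ.image θ).orderEmbOfFin hAcard
  have hmem : ∀ k, ∃ i, θ i = emb k := by
    intro k
    have := (Finset.univ.image θ).orderEmbOfFin_mem hAcard k
    rw [Finset.mem_image] at this
    obtain ⟨i, -, hi⟩ := this
    exact ⟨i, hi⟩
  choose π' hπ' using hmem
  refine seven_sorted_angles_false (fun k => emb k) emb.strictMono ?_ ?_ ?_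
  · show -π < emb 0
    rw [← hπ' 0]
    exact Complex.neg_pi_lt_arg _
  · show emb 6 ≤ π
    rw [← hπ' 6]
    exact Complex.arg_le_pi _
  · intro i j hij
    have hne : π' i ≠ π' j := by
      intro h
      apply hij
      apply emb.injective
      rw [← hπ' i, ← hπ' j, h]
    rw [← hπ' i, ← hπ' j]
    exact hC _ _ hne

/-- **At most six in the thin band.** A finite set of unit vectors of `ℝ³` with `|u₂| ≤ 1/5` and
pairwise inner products `≤ 1/2` has at most six elements (six is attained by a planar hexagon). -/
theorem card_thin_band_le_six {F : Finset (EuclideanSpace ℝ (Fin 3))} (hn : ∀ u ∈ F, ‖u‖ = 1)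
    (hz : ∀ u ∈ F, |u 2| ≤ 1 / 5)
    (hsep : ∀ u ∈ F, ∀ w ∈ F, u ≠ w → ⟪u, w⟫_ℝ ≤ 1 / 2) : F.card ≤ 6 := by
  by_contra h
  obtain ⟨F', hF', hcard⟩ := Finset.exists_subset_card_eq (show 7 ≤ F.card by omega)
  set eqv := (Finset.equivFinOfCardEq hcard).symm with heqv
  refine no_seven_in_thin_band (fun k => ((eqv k : F') : (EuclideanSpace ℝ (Fin 3)))) (fun k => hn _ (hF' (eqv k).2))
    (fun k => hz _ (hF' (eqv k).2))
    fun i j hij => hsep _ (hF' (eqv i).2) _ (hF' (eqv j).2) ?_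
  exact fun h => hij (eqv.injective (Subtype.val_injective h))


end Summit.Ventures.Crystal3D.Theorems

end
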